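import Summits.CriticalPhenomena.PercolationContinuityZ3.Theorems.PercNearOneGluingNoHeavyLowerTailTformChampionPairStability
import Summits.CriticalPhenomena.PercolationContinuityZ3.Theorems.PercNearOneGluingNoHeavyLowerTailTformRef3Certificate
import HarnessLib

/-!
# `NoHeavyLowerTail` (stmt-CriticalPhenomena-4575) — the crux from the REF3 certificate at CORE gluing instances only

Support file (prover `prim-hp-5`, hull-port cell, T-form calculus, gen 7; `--supports stmt-CriticalPhenomena-4575`).  No definitions,
no named facts, no sorries.  Combination of `Theorems.noHeavyLowerTail_of_coreGluedChampion` (the crux from the CORE gluing step: champion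
`q`, light non-relay `B` with `2 ≤ |B|`, every member with a positive pair, gluing `B` dethrones `q`, `q` a champion of no `w − y`, `q` with no
pair to `B`, and the set-induction hypothesis) with `Theorems.gluedSet_lsp_of_ref3` (the gluing step from the two-event comparison REF3):

* `noHeavyLowerTail_of_coreRef3` — `NoHeavyLowerTail` follows if every CORE instance admits a member `y`, a champion `p` of `w` without the
  pairs at `y`, and a set `D` of relays dominated there by `q`, with `μ(C_D ∩ G_p) ≤ μ(C_D ∩ G_q)` (`G_x` = "`x` light in `w/B`",
  `C_D` = the pairs `y–D` closed).

This is the typed residual of the T-form line at the end of gen 7 (seat memo OBSERVER-SET.md §18–21).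
-/

noncomputable section

namespace Summit.CriticalPhenomena.PercolationContinuityZ3.Theorems

open MeasureTheory Set Literature.Probability.LatticeModels Literature.Probability.Percolation
open scoped Classical BigOperators

/-- **The crux from REF3 at core gluing instances.** [cite: KozmaNitzan2024, Lemma 3(ii), Lemma 5 and Thm. 4 (pp. 6–14)] -/
theorem noHeavyLowerTail_of_coreRef3
    (hRef : ∀ (n : ℕ) (w : Sym2 (Fin n) → unitInterval) (A B : Finset (Fin n)) (q c : Fin n) (j : ℕ),
      (∀ (n' : ℕ) (w' : Sym2 (Fin n') → unitInterval) (A' B' : Finset (Fin n')) (q' c' : Fin n') (j' : ℕ),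
        (Finset.univ.filter fun e : Sym2 (Fin n') => w' e ≠ 0).card < (Finset.univ.filter fun e : Sym2 (Fin n) => w e ≠ 0).card →
        q' ∈ A' → c' ∈ A' → B'.Nonempty → (∀ m ∈ B', m ∉ A') →
        (∀ a ∈ A', (prodBernoulli w').real {ω : BondConfig (Fin n') | (A'.filter fun x => ω ∈ openConn a x).card ≤ j'} ≤
          (prodBernoulli w').real {ω : BondConfig (Fin n') | (A'.filter fun x => ω ∈ openConn q' x).card ≤ j'}) →
        (prodBernoulli w').real {ω : BondConfig (Fin n') | (∀ m ∈ B', ω ∉ openConn q' m) ∧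
            1 ≤ (A'.filter fun z => ∃ m ∈ B', ω ∈ openConn m z).card ∧ (A'.filter fun z => ∃ m ∈ B', ω ∈ openConn m z).card ≤ j'} +
          (prodBernoulli w').real {ω : BondConfig (Fin n') | ¬ 1 ≤ (A'.filter fun z => ∃ m ∈ B', ω ∈ openConn m z).card ∧
            (A'.filter fun z => ω ∈ openConn c' z).card ≤ j'} ≤
        (prodBernoulli w').real {ω : BondConfig (Fin n') | (∀ m ∈ B', ω ∉ openConn q' m) ∧ (A'.filter fun z => ω ∈ openConn q' z).card ≤ j'}) →
      q ∈ A → c ∈ A → 2 ≤ B.card → (∀ y ∈ B, y ∉ A) →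
      (∀ a ∈ A, (prodBernoulli w).real {ω : BondConfig (Fin n) | (A.filter fun x => ω ∈ openConn a x).card ≤ j} ≤
        (prodBernoulli w).real {ω : BondConfig (Fin n) | (A.filter fun x => ω ∈ openConn q x).card ≤ j}) →
      (∀ y ∈ B, (prodBernoulli w).real {ω : BondConfig (Fin n) | (A.filter fun x => ω ∈ openConn q x).card ≤ j} <
        (prodBernoulli w).real {ω : BondConfig (Fin n) | (A.filter fun x => ω ∈ openConn y x).card ≤ j}) →
      (∀ y ∈ B, ∃ v, v ≠ y ∧ w s(y, v) ≠ 0) →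
      (∃ a ∈ A, (prodBernoulli w).real {ω : BondConfig (Fin n) |
          ((∃ m ∈ B, ω ∈ openConn q m) → (A.filter fun z => ∃ m ∈ B, ω ∈ openConn m z).card ≤ j) ∧
            ((∀ m ∈ B, ω ∉ openConn q m) → (A.filter fun z => ω ∈ openConn q z).card ≤ j)} <
        (prodBernoulli w).real {ω : BondConfig (Fin n) |
          ((∃ m ∈ B, ω ∈ openConn a m) → (A.filter fun z => ∃ m ∈ B, ω ∈ openConn m z).card ≤ j) ∧
            ((∀ m ∈ B, ω ∉ openConn a m) → (A.filter fun z => ω ∈ openConn a z).card ≤ j)}) →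
      (∀ y ∈ B, ∃ a ∈ A, (prodBernoulli fun e => if e ∈ {e : Sym2 (Fin n) | y ∉ e} then w e else 0).real
            {ξ : BondConfig (Fin n) | (A.filter fun z => ξ ∈ openConn q z).card ≤ j} <
          (prodBernoulli fun e => if e ∈ {e : Sym2 (Fin n) | y ∉ e} then w e else 0).real
            {ξ : BondConfig (Fin n) | (A.filter fun z => ξ ∈ openConn a z).card ≤ j}) →
      (∀ y ∈ B, w s(q, y) = 0) →
      ∃ y ∈ B, ∃ p ∈ A,
        (∀ a ∈ A, (prodBernoulli fun e => if e ∈ {e : Sym2 (Fin n) | y ∉ e} then w e else 0).real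
            {ξ : BondConfig (Fin n) | (A.filter fun z => ξ ∈ openConn a z).card ≤ j} ≤
          (prodBernoulli fun e => if e ∈ {e : Sym2 (Fin n) | y ∉ e} then w e else 0).real
            {ξ : BondConfig (Fin n) | (A.filter fun z => ξ ∈ openConn p z).card ≤ j}) ∧
        ∃ D : Finset (Fin n),
          (∀ r ∈ D, r ∈ A ∧ (prodBernoulli fun e => if e ∈ {e : Sym2 (Fin n) | y ∉ e} then w e else 0).real
              {ξ : BondConfig (Fin n) | (A.filter fun z => ξ ∈ openConn r z).card ≤ j} ≤
            (prodBernoulli fun e => if e ∈ {e : Sym2 (Fin n) | y ∉ e} then w e else 0).real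
              {ξ : BondConfig (Fin n) | (A.filter fun z => ξ ∈ openConn q z).card ≤ j}) ∧
          (prodBernoulli w).real ({ω : BondConfig (Fin n) | ∀ r ∈ D, s(y, r) ∉ ω} ∩ {ω : BondConfig (Fin n) |
              ((∃ m ∈ B, ω ∈ openConn p m) → (A.filter fun z => ∃ m ∈ B, ω ∈ openConn m z).card ≤ j) ∧
                ((∀ m ∈ B, ω ∉ openConn p m) → (A.filter fun z => ω ∈ openConn p z).card ≤ j)}) ≤
            (prodBernoulli w).real ({ω : BondConfig (Fin n) | ∀ r ∈ D, s(y, r) ∉ ω} ∩ {ω : BondConfig (Fin n) |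
              ((∃ m ∈ B, ω ∈ openConn q m) → (A.filter fun z => ∃ m ∈ B, ω ∈ openConn m z).card ≤ j) ∧
                ((∀ m ∈ B, ω ∉ openConn q m) → (A.filter fun z => ω ∈ openConn q z).card ≤ j)})) :
    Summit.CriticalPhenomena.PercolationContinuityZ3.Theses.PercNearOneGluing.NoHeavyLowerTail := by
  refine noHeavyLowerTail_of_coreGluedChampion fun n w A B q c j ih hq hc hB hBA hch hl hall hinf hdd hnadj => ?_
  obtain ⟨y, hyB, p, hpA, hpch, D, hD, hcmp⟩ := hRef n w A B q c j ih hq hc hB hBA hch hl hall hinf hdd hnadj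
  exact gluedSet_lsp_of_ref3 w A B D y p q c j ih hq hc hBA hyB hB (hall y hyB) hpA hpch hD hcmp

end Summit.CriticalPhenomena.PercolationContinuityZ3.Theorems

end
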